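import Summits.QuantumFields.BalabanUV.T4Continuum.Spine.NE1p.DressedSmallFieldOnCoresSlot
import Summits.QuantumFields.BalabanUV.T4Continuum.Spine.NE1p.DressedSmallFieldCoresMassWitness

/-!
# T⁴ programme, spine estimate NE1′ (node O3b/H2) — WITNESS «THE TERM-DEPENDENT POLYMER FAMILY IS INHABITED»: the owner's N0r §2 ENDs
# `attachedPart_locE_le_of_coresAt_pencil_mass` AND `muPart_locE_le_of_coresAt_pencil_mass` (`Spine/NE1p/DressedSmallFieldOnCoresSlot`,
# p228506) APPLIED ONCE EACH BY NAME on a decided TWO-TERM family whose polymer-family TYPES DIFFER between the terms (`Unit` and `Bool`)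
# — PART 1: the cores, the dependent family, (B3) as a letter budget, the ENDs fire

Cell `pub-balaban`, sub-cell `t4`, row NE1′ formalisation crew (`t4/formal/NE1p/LEAVES.md` row W41 ∕ DAG N29zy; INTENT HOME/CLAIMS.log l.18111,
BOOKED typer R-T120 (ii), STAGED l.18331), unit
`b2b-balaban-t4-ne1p-formalise-leaf-09` (gen 11).  ADDITIVE — imports the owner's N0r `Spine/NE1p/DressedSmallFieldOnCoresSlot` (t4-ne1p-p1
g28; → N0q → N0p) and W35 `Spine/NE1p/DressedSmallFieldCoresMassWitness` (leaf-09 g10; → W33 `DressedSmallFieldCoresWitness` → W24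
`DressedSmallFieldTorusWitness`, row NE5's `Support/B13HistWitness`) ONLY; toy DATA `def`s + theorems; 0 `def … : Prop`, 0 cite, 0 sorry;
nothing of N0r ∕ N0q ∕ N0p ∕ W33 ∕ W35 ∕ W24 ∕ row NE5 is restated — `coreW`, `liveTable`, `E1`, `crd`, `ctr0`, `hroom0`, `cM`, `letterMass_coreW`,
`letterGauss_E1`, `hsmall_W`, `hsmall_mu`, `incr`, `integrable_term`, `integral_incr_pos`, `norm_cexp_readOut_le`, `gaussian_E1`, `X₀`,
`exp_locE_cube`, `hrate_torus`, `torus_consts`, `K₀_four` are used BY NAME.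

WHY.  N0r's new generality over N0q ∕ N0p §4 is a TYPE (N0r header: «the obstacle was a TYPE, not a fact»): its §1∕§2 take core families
`𝔊 k i X : BiCore P (dom k i) Op (β k i) (α k i)` whose polymer-family type `𝒴 k i` and placement `dom k i : 𝒴 k i → C.Dom` VARY WITH THE
TERM, where N0q's `attachedPart_locE_le_of_cores_pencil_mass` has ONE `𝒴` and ONE `dom` for all terms.  N0r §3 uses §2 at the substrate's
abstract `𝒴 Z j`; the crew's faces keep `𝒴` abstract; every decided core family in the tree (W33∕W35 `coreFam`, row NE5's toys) is
constant-`𝒴`.  This file gives §2 a DECIDED family that N0q's END cannot even STATE: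
* §1 a TWO-LABEL core `coreV c r : BiCore toyFrame domV ℂ Unit E1` over row NE5's `toyFrame` — polymer family `Finset.univ : Finset Bool`,
  the two labels placed at the carrier domains `1` and `0` (`domV`), contour weight `r` on both circles, field maps `v ↦ v 0` and `v ↦ −(v 0)`
  (opposite orientation at the second label); its read-out READS THE TABLE AT TWO LABELS, `readOut p v h = r·V″(h)(1, v 0) + r·V″(h)(0, −v 0)`,
  so along W33's live table `= s·(2r)·e^{−(v 0)²}`; letters `N₁ = 2r`, letter mass `|c|·√(2π)` (W35's `letterGauss_E1`);
* §2 THE DEPENDENT FAMILY `GD k b X : BiCore toyFrame (domD k b) ℂ Unit E1` over the term index `Bool`: `YD k false = Unit` carrying W33's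
  one-label core `coreW (cM r∕2) r` BY NAME, `YD k true = Bool` carrying `coreV (cM (2r)∕2) r`; **`YD_not_equiv : ¬ Nonempty (YD k true ≃
  YD k false)`** (card 2 ≠ 1) — no constant-`𝒴` re-indexing of this family exists; the activity of record `actD k s Z := Σ_{b ∈ termsD Z}
  (GD k b k).termAt 0 (0 + s • liveTable)` (both terms on W24's one-cube domain `X₀`, none elsewhere; `hact`∕`hscale` by `rfl`);
* §3 (B3) AS N0q's LETTER BUDGET, MET at W24's located constant SPLIT ACROSS THE TWO TERMS: `hM3_D` (table-strength pencil, `ϱ = 2`) and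
  `hM3_Dmu` (source pencil, `‖s‖ < μ₁ ≤ 2`) — each term's letter mass times its read-out growth is `≤ A∕2` (`budget_half`: the weight
  `cM x∕2 = A·e^{−2x}∕(2√(2π))` pays for the growth `e^{x·u}`, `u ≤ 2`, at `x = N₁ ∈ {r, 2r}` — the two-label core pays `e^{4r}` for its doubled
  `N₁`); decay factor `1`: `d(X₀) = 0`, said plainly;
* §4 **`depCoresEnd_fires`** ∕ **`depCoresMuEnd_fires`** — N0r §2's two ENDs ONCE EACH BY NAME with W33's `ctr0`∕`hroom0`, NE5's toy letters
  `(mq, bq, N₀) = (1, 0, 1)` discharged INLINE per term (`cases b`), W24's `hrate_torus`, W33's `hsmall_W` ∕ W35's `hsmall_mu`; conclusions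
  LITERAL; closed forms `≤ 2·K₀(64,8)` and `≤ K₀(64,8)·μ₀∕(μ₁ − μ₀)` by `torus_consts`∕`K₀_four`;
* PART 2 (`Spine/NE1p/DressedSmallFieldDepCoresWitnessLive`, imports THIS FILE ONLY) carries the GENUINE records: the two terms in
  closed form (the read-outs EVALUATED), the increment at a real source `t` as `cM(2r)∕2·∫ incr (t·2r) + cM r∕2·∫ incr (t·r)`, hence
  `actD_mu_live`∕`actD_live`, `norm_actD_X₀_lt_one`, and `depCoresMuEnd_live`∕`depCoresEnd_live`: the ENDs' bounded quantities are NOT zero.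

WORDING OF RECORD (crew row W41 = DAG N29zy, typer R-T120 (ii): the holder's sentence + rider ADOPTED verbatim; the code spells `𝒴D`∕`𝔊D`
as `YD`∕`GD`): «OUR decided two-term datum over row NE5's toy frame; the dependent type family `𝒴D`∕`domD` is OURS — it shows N0r's dependent-`dom`
generality is inhabited and that N0q's constant-`dom` END cannot even state this activity, nothing about Bałaban's polymer-indexed (2.14) data
((B1b) NOT claimed); (B3)'s clause is MET because the weights are CHOSEN to split W24's located constant — (B3) UNPRINTED (G-ne9p2-5, shared with
NE9); toy arithmetic only, no numeral of [Balaban1988RGII]; 0 binders instantiated on Bałaban's densities; wall v1.7 (T4-DAG v43) does NOT move».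

HONEST FRAMING.  A DECIDED TOY ([folklore]; 0 sorry; 0 citations; no `def … : Prop` — the `def`s are toy DATA).  The two cores are
THEOREM-backed instances of the cell's typed FORMAT of (2.14) (`B13TermParamGaussianBi.BiCore`) over row NE5's TOY measurable frame with
NE5's DECOUPLED toy letters `N := 1`, `q := ‖v‖²` — NOT Bałaban's (2.14) terms, NOT rows NE2∕NE3's Gaussian data, NOT the substrate's
`slotsOfRecord`∕`actOfLetters` (N0r §3 is NOT applied here; its witness is row W40's); the weights `cM x∕2` are CHOSEN so that (B3)'s letter-mass
clause holds — (B3) = GAPS G-ne9p2-5 stays UNPRINTED for Bałaban's cores; `2`, `√(2π)`, `e^{−2x}` are OUR toy arithmetic — no numeral of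
[Balaban1988RGII]; the type-level statement `YD_not_equiv` is about OUR index types, not about print; 0 binders instantiated on Bałaban's
densities; no wall item; wall v1.7 (T4-DAG v43) does NOT move; R-t4r2-Q2 NOT met thereby; NE1′ ⇐ the named binders — NOT proved, NOT printed;
spine PROVED 0∕9; count 9 unchanged.  Rung (B)+1 on ONE finite four-torus — NOT infinite volume, NOT a mass gap, NOT OS on ℝ⁴, NOT Clay.
HONEST DEPENDENCY: continuum YM on T⁴ ⇐ BetaPertH ∧ nine spine estimates (0/9 proved); BetaPertH ⇐ (D1) ∧ (D4) ∧ CAP+tail; G-an2-4 gates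
asym, D1 and NE2/3/4.
-/

noncomputable section

namespace Summit.QuantumFields.BalabanUV.T4Continuum.NE1p.DressedSmallFieldDepCoresWitness

open Set Metric MeasureTheory Complex
open scoped BigOperators
open Literature.MathematicalPhysics.QuantumFieldTheory.Balaban1983to89
open Literature.MathematicalPhysics.QuantumFieldTheory.Balaban1983to89.B12TreeDecay (K₀ K₀_pos)
open Literature.MathematicalPhysics.QuantumFieldTheory.Balaban1983to89.B13Resummation (locE)
open Literature.MathematicalPhysics.QuantumFieldTheory.Balaban1983to89.TreeLengthTorus (TDom tsys torusTreeLen torusTreeLen_singleton)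
open Literature.MathematicalPhysics.QuantumFieldTheory.Balaban1983to89.TreeLengthTorusGeometry (tgeometry TTouch)
open Summit.QuantumFields.BalabanUV.T4Continuum.B13HistDatum (level136)
open Summit.QuantumFields.BalabanUV.T4Continuum.B13HistMeasurable (B13HistM)
open Summit.QuantumFields.BalabanUV.T4Continuum.B13HistWitness (toyFrame level136_toyFrame)
open Summit.QuantumFields.BalabanUV.T4Continuum.B13TermParamGaussianBi (BiCore)
open Summit.QuantumFields.BalabanUV.T4Continuum.InsertionLinearClass (linToyCarriers)
open Summit.QuantumFields.BalabanUV.T4Continuum.NE1p.DressedSmallFieldTorusWitness (X₀ X₀_val eq_X₀_iff hrate_torus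
  dressedConst_le_one exp_locE_cube)
open Summit.QuantumFields.BalabanUV.T4Continuum.NE1p.DressedSmallFieldGeometry (torus_consts)
open Summit.QuantumFields.BalabanUV.T4Continuum.NE1p.DressedSmallFieldGeometryFaces (K₀_four)
open Summit.QuantumFields.BalabanUV.T4Continuum.NE1p.DressedSmallFieldCoresWitness (E1 crd measurable_crd liveTable VppM_liveTable
  norm_liveTable_le coreW chi_coreW readOut_coreW_smul_liveTable N₁_coreW ctr0 hroom0 gaussian_E1 Acst Acst_pos hsmall_W incr
  integral_incr_pos integrable_gauss_E1 norm_cexp_readOut_le integrable_term)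
open Summit.QuantumFields.BalabanUV.T4Continuum.NE1p.DressedSmallFieldCoresMassWitness (letterGauss_E1 letterMass_coreW cM cM_pos
  hsmall_mu)
open Summit.QuantumFields.BalabanUV.T4Continuum.NE1p.DressedSmallFieldOnCoresSlot (attachedPart_locE_le_of_coresAt_pencil_mass
  muPart_locE_le_of_coresAt_pencil_mass)

/-! ## §1 A TWO-LABEL (2.14)-core of the format of record (toy DATA): polymer family `Bool`, two carrier domains -/

/-- The placement of the two polymer labels at the carrier domains `1` and `0` (toy DATA). [folklore] -/
def domV : Bool → ℕ := fun Y => cond Y 1 0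

/-- **THE TWO-LABEL CORE** (toy DATA) [decided toy]: parameters `Unit` with the Dirac mass, Cauchy weight the constant `c` (`wB = |c|`),
NE5's DECLARED toy letters `N := 1`, `q(o, p, v) := ‖v‖²`, no characteristic-function constraints, polymer family ALL OF `Bool` placed by
`domV`, contour weight `τ := r` ON both circles `rad := r`, field maps `B true v := v 0`, `B false v := −(v 0)`.  Not Bałaban's (2.14) data.
[folklore] -/
def coreV (c r : ℝ) (hr : 0 ≤ r) : BiCore toyFrame domV ℂ Unit E1 where
  lam := Measure.dirac ()
  finite := by infer_instance
  w := fun _ => (c : ℂ)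
  measW := measurable_const
  wB := |c|
  norm_w_le := fun _ => by rw [Complex.norm_real, Real.norm_eq_abs]
  N := fun _ _ => 1
  q := fun _ _ v => ((‖v‖ ^ 2 : ℝ) : ℂ)
  cons := []
  nsign := 0
  D := Finset.univ
  τ := fun _ _ => (r : ℂ)
  measτ := fun _ => measurable_const
  rad := fun _ => r
  rad_nonneg := fun _ => hr
  norm_τ_le := fun _ _ => by rw [Complex.norm_real, Real.norm_eq_abs, abs_of_nonneg hr]
  B := fun Y v => cond Y (crd v) (-crd v)
  measB := fun Y => by
    cases Y
    · exact measurable_crd.neg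
    · exact measurable_crd

variable (c r : ℝ) (hr : 0 ≤ r)

/-- No constraints: the potential-free factor is `1`. [folklore] -/
theorem chi_coreV (v : E1) : (coreV c r hr).chi v = 1 := by unfold BiCore.chi BiCore.chiSet; simp [coreV]

/-- **THE READ-OUT READS THE TABLE AT TWO LABELS**: `readOut p v h = r·V″(h)(1, v 0) + r·V″(h)(0, −(v 0))`. [folklore] -/
theorem readOut_coreV (p : Unit) (v : E1) (h : B13HistM toyFrame) :
    (coreV c r hr).readOut p v h = (r : ℂ) * toyFrame.VppM h 1 (crd v) + (r : ℂ) * toyFrame.VppM h 0 (-crd v) := by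
  rw [BiCore.readOut_apply]
  show ∑ Y ∈ (Finset.univ : Finset Bool), (r : ℂ) * _ = _
  rw [Fintype.sum_bool]
  rfl

/-- … along the table pencil `s • liveTable`: `readOut p v (s • liveTable) = s·((2r)·e^{−(v 0)²})` — the two labels contribute equally
(W33's table has the potential `e^{−φ²}` at every domain, and `(−φ)² = φ²`). [folklore] -/
theorem readOut_coreV_smul_liveTable (p : Unit) (v : E1) (s : ℂ) :
    (coreV c r hr).readOut p v (s • liveTable) = s * (((2 * r : ℝ) : ℂ) * (Real.exp (-(crd v ^ 2)) : ℂ)) := by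
  rw [map_smul, smul_eq_mul, readOut_coreV, VppM_liveTable, VppM_liveTable, neg_sq]
  push_cast
  ring

/-- The core's letter `N₁ = r·1 + r·1 = 2r` (two labels, the toy frame's (1.36) weight `1` at both domains). [folklore] -/
theorem N₁_coreV : (coreV c r hr).N₁ = 2 * r := by
  unfold BiCore.N₁
  show ∑ Y ∈ (Finset.univ : Finset Bool), r * level136 toyFrame.consts (linToyCarriers.d (domV Y)) = 2 * r
  rw [Fintype.sum_bool, level136_toyFrame]
  ring

/-- **THE LETTER MASS OF THE TWO-LABEL CORE** [decided toy]: at NE5's toy letters `(mq, bq, N₀) = (1, 0, 1)`, N0q's table-blind scalar is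
`1·(|c|·1·e⁰)·(π∕(1∕2))^{1∕2} = |c|·√(2π)` (W35's `letterGauss_E1` BY NAME). [folklore] -/
theorem letterMass_coreV :
    (coreV c r hr).lam.real univ * ((coreV c r hr).wB * (1 : ℝ) * Real.exp (0 : ℝ)) *
        (Real.pi / ((1 : ℝ) / 2)) ^ (Module.finrank ℝ E1 / 2 : ℝ) = |c| * Real.sqrt (2 * Real.pi) := by
  rw [letterGauss_E1, Real.exp_zero, mul_one, mul_one]
  show (Measure.dirac ()).real univ * |c| * Real.sqrt (2 * Real.pi) = _
  rw [probReal_univ, one_mul]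

/-! ## §2 THE DEPENDENT FAMILY: polymer-family TYPES `Unit` (term `false`) and `Bool` (term `true`) — and they are NOT equinumerous -/

/-- The polymer-family TYPE of each term (toy DATA): `Unit` for the term `false`, `Bool` for the term `true`. [folklore] -/
abbrev YD : ℕ → Bool → Type := fun _ b =>
  match b with
  | true => Bool
  | false => Unit

/-- The placement of each term's polymer family in the carriers (toy DATA): `domV` for `true`, the domain `0` for `false`. [folklore] -/
abbrev domD : ∀ (k : ℕ) (b : Bool), YD k b → ℕ := fun _ b =>
  match b with
  | true => domV
  | false => fun _ => 0

section Torus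
variable (N : ℕ) [NeZero N]

/-- **THE DEPENDENT CORE FAMILY** (toy DATA): at the term `false` W33's one-label core `coreW` (BY NAME) at weight `cM r∕2`, at the term
`true` the two-label core `coreV` at weight `cM (2r)∕2` — one `BiCore toyFrame (domD k b) ℂ Unit E1` per term `b`, the polymer-family type
depending on `b`. [folklore] -/
def GD : ∀ (k : ℕ) (b : Bool), ℕ → BiCore toyFrame (domD k b) ℂ Unit E1 := fun _ b _ =>
  match b with
  | true => coreV (cM (2 * r) / 2) r hr
  | false => coreW (cM r / 2) r hr

/-- The term `true` carries the two-label core. [folklore] -/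
@[simp] theorem GD_true (k X : ℕ) : GD r hr k true X = coreV (cM (2 * r) / 2) r hr := rfl
/-- The term `false` carries W33's one-label core. [folklore] -/
@[simp] theorem GD_false (k X : ℕ) : GD r hr k false X = coreW (cM r / 2) r hr := rfl

/-- The two polymer-family types have `2` and `1` elements. [folklore] -/
theorem card_YD (k : ℕ) : Fintype.card (YD k true) = 2 ∧ Fintype.card (YD k false) = 1 := ⟨Fintype.card_bool, Fintype.card_unit⟩

/-- **THE POLYMER-FAMILY TYPES OF THE TWO TERMS ARE NOT EQUINUMEROUS** [decided toy]: no bijection `YD k true ≃ YD k false` exists — so this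
family admits NO constant-`𝒴` re-indexing, i.e. it lies outside the reach of N0q's ∕ N0p §4's constant-`dom` ENDs and inside N0r §2's. [folklore] -/
theorem YD_not_equiv (k : ℕ) : ¬ Nonempty (YD k true ≃ YD k false) := fun ⟨e⟩ => by
  have h := Fintype.card_congr e
  rw [(card_YD k).1, (card_YD k).2] at h
  omega

open Classical in
/-- The term indexing (toy DATA): BOTH terms on W24's one-cube domain `X₀`, none elsewhere. [folklore] -/
def termsD (Z : TDom 4 N) : Finset Bool := if Z.1 = {0} then Finset.univ else ∅

/-- On `X₀` both terms are present. [folklore] -/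
theorem termsD_X₀ : termsD N (X₀ N) = Finset.univ := by unfold termsD; rw [if_pos (X₀_val N)]

/-- THE ACTIVITY OF RECORD (toy DATA): the sum of the dependent family's terms along the pencil `s ↦ 0 + s • liveTable` — BY DEFINITION,
so N0r §2's `hact` holds by `rfl` for the table-strength pencil (`w := liveTable`) AND for the source pencil (`v := liveTable`), and
`hscale` by `rfl` (`emb Z := k`). [folklore] -/
def actD (k : ℕ) (s : ℂ) (Z : TDom 4 N) : ℂ :=
  ∑ b ∈ termsD N Z, (GD r hr k b k).termAt (0 : ℂ) ((0 : B13HistM toyFrame) + s • liveTable)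

/-! ## §3 (B3) AS A LETTER BUDGET, MET at W24's located constant SPLIT across the two terms -/

/-- **HALF THE BUDGET PER TERM** [arith]: the weight `cM x∕2 = A·e^{−2x}∕(2√(2π))` times the Gaussian letter `√(2π)` times a read-out
growth `e^{x·u}` with `u ≤ 2` is `≤ A∕2`. [folklore] -/
theorem budget_half (x : ℝ) (hx : 0 ≤ x) {u : ℝ} (hu : u ≤ 2) :
    |cM x / 2| * Real.sqrt (2 * Real.pi) * Real.exp (x * u) ≤ Acst / 2 := by
  rw [abs_of_pos (half_pos (cM_pos x))]
  have h2π : 0 < Real.sqrt (2 * Real.pi) := Real.sqrt_pos.2 (by positivity)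
  unfold cM
  calc Acst * Real.exp (-(2 * x)) / Real.sqrt (2 * Real.pi) / 2 * Real.sqrt (2 * Real.pi) * Real.exp (x * u)
      = Acst / 2 * Real.exp (-(2 * x) + x * u) := by rw [Real.exp_add]; field_simp
    _ ≤ Acst / 2 * Real.exp 0 := by
        gcongr
        · exact (half_pos Acst_pos).le
        · nlinarith
    _ = Acst / 2 := by rw [Real.exp_zero, mul_one]

/-- The tree length of the one-cube domain is `0`. [folklore] -/
theorem dj_X₀ : (tsys 4 N).dj (X₀ N) = 0 := by
  show torusTreeLen (X₀ N).1 = 0; rw [X₀_val]; exact torusTreeLen_singleton 0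

/-- **`hM3` FOR THE TABLE-STRENGTH PENCIL** (`ϱ = 2`, `R₀ = ‖0‖ + 2‖liveTable‖`) [decided toy], in the LITERAL binder shape of N0r §2: at `X₀`
the two terms' letter masses times read-out growths are `|cM(2r)∕2|·√(2π)·e^{2r·2‖liveTable‖} + |cM r∕2|·√(2π)·e^{r·2‖liveTable‖} ≤ A∕2 + A∕2
= 0 + 2·(A∕2)` (decay factor `1`: `d(X₀) = 0`); vacuous elsewhere (no term). [folklore] -/
theorem hM3_D (k : ℕ) (R : ℝ) :
    ∀ Z : (tsys 4 N).Dom, (tgeometry 4 N).cubes Z ⊆ (tgeometry 4 N).cubes (X₀ N) →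
      ∑ i ∈ termsD N Z, (GD r hr k i k).lam.real univ *
          ((GD r hr k i k).wB * (fun (_ : ℕ) (_ : Bool) (_ : ℕ) => (1 : ℝ)) k i k *
            Real.exp ((fun (_ : ℕ) (_ : Bool) (_ : ℕ) => (0 : ℝ)) k i k)) *
          (Real.pi / ((fun (_ : ℕ) (_ : Bool) (_ : ℕ) => (1 : ℝ)) k i k / 2)) ^ (Module.finrank ℝ E1 / 2 : ℝ) *
        Real.exp ((GD r hr k i k).N₁ * (‖(0 : B13HistM toyFrame)‖ + 2 * ‖liveTable‖)) ≤
      (0 + 2 * (Acst / 2)) * Real.exp (-(R * (tsys 4 N).dj Z)) := by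
  intro Z hZ
  have hZX : Z = X₀ N := (eq_X₀_iff N Z).1 ((Finset.Nonempty.subset_singleton_iff Z.2.1).1 hZ)
  subst hZX
  rw [termsD_X₀, Fintype.sum_bool]
  simp only [GD_true, GD_false]
  rw [letterMass_coreV, letterMass_coreW, N₁_coreV, N₁_coreW, norm_zero, zero_add, dj_X₀, mul_zero, neg_zero, Real.exp_zero, mul_one]
  have hT : 2 * ‖liveTable‖ ≤ 2 := by linarith [norm_liveTable_le]
  have h2r : 0 ≤ 2 * r := by positivity
  linarith [budget_half (2 * r) h2r hT, budget_half r hr hT]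

/-- **`hM3` FOR THE SOURCE PENCIL** (`h₀ = 0`, `v = liveTable`, `‖s‖ < μ₁ ≤ 2`, constant `A`) [decided toy]: `≤ A∕2 + A∕2 = A` at `X₀`. [folklore] -/
theorem hM3_Dmu {μ₁ : ℝ} (hμ₁ : μ₁ ≤ 2) (k : ℕ) (R : ℝ) :
    ∀ Z : (tsys 4 N).Dom, (tgeometry 4 N).cubes Z ⊆ (tgeometry 4 N).cubes (X₀ N) →
      ∑ i ∈ termsD N Z, (GD r hr k i k).lam.real univ *
          ((GD r hr k i k).wB * (fun (_ : ℕ) (_ : Bool) (_ : ℕ) => (1 : ℝ)) k i k *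
            Real.exp ((fun (_ : ℕ) (_ : Bool) (_ : ℕ) => (0 : ℝ)) k i k)) *
          (Real.pi / ((fun (_ : ℕ) (_ : Bool) (_ : ℕ) => (1 : ℝ)) k i k / 2)) ^ (Module.finrank ℝ E1 / 2 : ℝ) *
        Real.exp ((GD r hr k i k).N₁ * (‖(0 : B13HistM toyFrame)‖ + μ₁ * ‖liveTable‖)) ≤
      Acst * Real.exp (-(R * (tsys 4 N).dj Z)) := by
  intro Z hZ
  have hZX : Z = X₀ N := (eq_X₀_iff N Z).1 ((Finset.Nonempty.subset_singleton_iff Z.2.1).1 hZ)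
  subst hZX
  rw [termsD_X₀, Fintype.sum_bool]
  simp only [GD_true, GD_false]
  rw [letterMass_coreV, letterMass_coreW, N₁_coreV, N₁_coreW, norm_zero, zero_add, dj_X₀, mul_zero, neg_zero, Real.exp_zero, mul_one]
  have hT : μ₁ * ‖liveTable‖ ≤ 2 :=
    (mul_le_mul hμ₁ norm_liveTable_le (norm_nonneg _) (by norm_num)).trans (by norm_num)
  have h2r : 0 ≤ 2 * r := by positivity
  linarith [budget_half (2 * r) h2r hT, budget_half r hr hT]

/-! ## §4 THE ENDs FIRE: N0r §2's two dependent-family ENDs applied ONCE EACH BY NAME -/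

open Classical in
/-- **N0r §2's `attachedPart_locE_le_of_coresAt_pencil_mass` FIRES ON THE DEPENDENT FAMILY** [decided toy]: `𝔊 := GD` (polymer-family types
`Unit`∕`Bool` per term), W33's `ctr0`∕`hroom0`, NE5's toy letters `(mq, bq, N₀) = (1, 0, 1)` discharged INLINE per term (`cases` on the term),
the pencil's two radius inequalities, `hscale`∕`hact` by `rfl`, W24's `hrate_torus`, W33's `hsmall_W`, `hM3_D`, `hϱ : 2 ≤ 2`, `hϱA`.
Conclusion LITERAL. [folklore] -/
theorem depCoresEnd_fires (k : ℕ) :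
    ‖locE (tgeometry 4 N).ι (tgeometry 4 N).cubes (actD r hr N k 1) ((tgeometry 4 N).cubes (X₀ N)) -
        locE (tgeometry 4 N).ι (tgeometry 4 N).cubes (actD r hr N k 0) ((tgeometry 4 N).cubes (X₀ N))‖ ≤
      4 * (Real.exp 1 * (tgeometry 4 N).ν * (tgeometry 4 N).c₁ * (tgeometry 4 N).K₀ ^ 2) * (Acst / 2) *
        Real.exp (-(0 * (tsys 4 N).dj (X₀ N))) :=
  attachedPart_locE_le_of_coresAt_pencil_mass (tsys 4 N) (tgeometry 4 N) (GD r hr)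
    (W := Set.univ) (ctr := ctr0) (ROp := fun _ => 1) (RHist := fun _ => 2) (R' := fun _ => 2)
    (mq := fun _ _ _ => 1) (bq := fun _ _ _ => 0) (N₀ := fun _ _ _ => 1)
    hroom0 (fun _ _ _ _ _ _ _ => one_pos)
    (fun _ _ _ _ _ _ i => by
      cases i <;> exact ⟨fun _ _ => aestronglyMeasurable_const, fun _ => differentiableOn_const _, fun _ _ _ => by
        show ‖(1 : ℂ)‖ ≤ 1; rw [norm_one]⟩)
    (fun _ _ _ _ _ _ i => by
      cases i <;> exact ⟨fun _ _ => (Complex.measurable_ofReal.comp (measurable_snd.norm.pow_const 2)).aestronglyMeasurable,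
        fun _ _ => differentiableOn_const _, fun _ _ _ v => by
          show 1 * ‖v‖ ^ 2 - 0 ≤ (((‖v‖ ^ 2 : ℝ) : ℂ)).re; rw [Complex.ofReal_re]; simp⟩)
    (g := fun _ => 0) (Set.mem_univ _) (U := ()) (o := 0) (h₀ := 0) (w := liveTable) (ϱ := 2)
    (by show ‖(0 : ℂ) - 0‖ ≤ 1; simp)
    (by show ‖(0 : B13HistM toyFrame) - 0‖ + 2 * ‖liveTable‖ ≤ 2; rw [sub_zero, norm_zero, zero_add];
        linarith [norm_liveTable_le])
    (emb := fun _ => k) (fun _ => rfl) (terms := termsD N) (act := actD r hr N k) (fun _ _ _ => rfl)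
    (A₀ := 0) (A₁ := Acst / 2) (R := 2 * (tgeometry 4 N).κ₀ + 2) (r₁ := 0) (b₅ := 0) (X₀ := X₀ N)
    le_rfl (by have := Acst_pos; positivity) le_rfl (by norm_num) (hrate_torus N) (hsmall_W N) (hM3_D r hr N k _)
    le_rfl (by have := Acst_pos; linarith)

open Classical in
/-- … in CLOSED FORM: `≤ 4·(e·9·64·K₀(64,8)²)·(A∕2) = 2·K₀(64,8)` (pv22's constants by `torus_consts`∕`K₀_four` BY NAME). [folklore] -/
theorem depCoresEnd_fires_closed (k : ℕ) :
    ‖locE (tgeometry 4 N).ι (tgeometry 4 N).cubes (actD r hr N k 1) ((tgeometry 4 N).cubes (X₀ N)) -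
        locE (tgeometry 4 N).ι (tgeometry 4 N).cubes (actD r hr N k 0) ((tgeometry 4 N).cubes (X₀ N))‖ ≤ 2 * K₀ 64 8 := by
  refine (depCoresEnd_fires r hr N k).trans (le_of_eq ?_)
  rw [(torus_consts N).1, (torus_consts N).2.2, K₀_four, zero_mul, neg_zero, Real.exp_zero, mul_one]
  unfold Acst
  have hK := K₀_pos (64 : ℝ) 8
  have he := Real.exp_pos 1
  field_simp
  ring

open Classical in
/-- **N0r §2's `muPart_locE_le_of_coresAt_pencil_mass` FIRES ON THE DEPENDENT FAMILY** [decided toy]: the SAME activity read along the SOURCE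
pencil `s ↦ 0 + s • liveTable` (`h₀ := 0`, `v := liveTable`), `‖s‖ < μ₁ ≤ 2` (so the pencil stays in NE5's class of history radius `2`),
`hM3_Dmu` at the constant `A`, W35's `hsmall_mu`; for `0 < μ₀ < μ₁`, `‖μ‖ ≤ μ₀`.  Conclusion LITERAL. [folklore] -/
theorem depCoresMuEnd_fires {μ₁ μ₀ : ℝ} {μ : ℂ} (hμ₁ : μ₁ ≤ 2) (h0 : 0 < μ₀) (h01 : μ₀ < μ₁) (hμ : ‖μ‖ ≤ μ₀) (k : ℕ) :
    ‖locE (tgeometry 4 N).ι (tgeometry 4 N).cubes (actD r hr N k μ) ((tgeometry 4 N).cubes (X₀ N)) -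
        locE (tgeometry 4 N).ι (tgeometry 4 N).cubes (actD r hr N k 0) ((tgeometry 4 N).cubes (X₀ N))‖ ≤
      Real.exp 1 * (tgeometry 4 N).ν * (tgeometry 4 N).c₁ * (tgeometry 4 N).K₀ ^ 2 * Acst *
        Real.exp (-(0 * (tsys 4 N).dj (X₀ N))) * (μ₀ / (μ₁ - μ₀)) :=
  muPart_locE_le_of_coresAt_pencil_mass (tsys 4 N) (tgeometry 4 N) (GD r hr)
    (W := Set.univ) (ctr := ctr0) (ROp := fun _ => 1) (RHist := fun _ => 2) (R' := fun _ => 2)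
    (mq := fun _ _ _ => 1) (bq := fun _ _ _ => 0) (N₀ := fun _ _ _ => 1)
    hroom0 (fun _ _ _ _ _ _ _ => one_pos)
    (fun _ _ _ _ _ _ i => by
      cases i <;> exact ⟨fun _ _ => aestronglyMeasurable_const, fun _ => differentiableOn_const _, fun _ _ _ => by
        show ‖(1 : ℂ)‖ ≤ 1; rw [norm_one]⟩)
    (fun _ _ _ _ _ _ i => by
      cases i <;> exact ⟨fun _ _ => (Complex.measurable_ofReal.comp (measurable_snd.norm.pow_const 2)).aestronglyMeasurable,
        fun _ _ => differentiableOn_const _, fun _ _ _ v => by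
          show 1 * ‖v‖ ^ 2 - 0 ≤ (((‖v‖ ^ 2 : ℝ) : ℂ)).re; rw [Complex.ofReal_re]; simp⟩)
    (g := fun _ => 0) (Set.mem_univ _) (U := ()) (o := 0) (h₀ := 0) (v := liveTable) (μ₁ := μ₁)
    (by show ‖(0 : ℂ) - 0‖ ≤ 1; simp)
    (by show ‖(0 : B13HistM toyFrame) - 0‖ + μ₁ * ‖liveTable‖ ≤ 2; rw [sub_zero, norm_zero, zero_add];
        exact (mul_le_mul hμ₁ norm_liveTable_le (norm_nonneg _) (by norm_num)).trans (by norm_num))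
    (emb := fun _ => k) (fun _ => rfl) (terms := termsD N) (act := actD r hr N k) (fun _ _ _ => rfl)
    (A := Acst) (R := 2 * (tgeometry 4 N).κ₀ + 2) (r₁ := 0) (b₅ := 0) (X₀ := X₀ N)
    Acst_pos.le le_rfl (by norm_num) (hrate_torus N) (hsmall_mu N) (hM3_Dmu r hr N hμ₁ k _) h0 h01 hμ

open Classical in
/-- … in CLOSED FORM: the μ-part is `≤ K₀(64,8)·μ₀∕(μ₁ − μ₀)`. [folklore] -/
theorem depCoresMuEnd_fires_closed {μ₁ μ₀ : ℝ} {μ : ℂ} (hμ₁ : μ₁ ≤ 2) (h0 : 0 < μ₀) (h01 : μ₀ < μ₁) (hμ : ‖μ‖ ≤ μ₀) (k : ℕ) :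
    ‖locE (tgeometry 4 N).ι (tgeometry 4 N).cubes (actD r hr N k μ) ((tgeometry 4 N).cubes (X₀ N)) -
        locE (tgeometry 4 N).ι (tgeometry 4 N).cubes (actD r hr N k 0) ((tgeometry 4 N).cubes (X₀ N))‖ ≤
      K₀ 64 8 * (μ₀ / (μ₁ - μ₀)) := by
  refine (depCoresMuEnd_fires r hr N hμ₁ h0 h01 hμ k).trans (le_of_eq ?_)
  rw [(torus_consts N).1, (torus_consts N).2.2, K₀_four, zero_mul, neg_zero, Real.exp_zero, mul_one]
  unfold Acst
  have hK := K₀_pos (64 : ℝ) 8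
  have he := Real.exp_pos 1
  field_simp

end Torus

end Summit.QuantumFields.BalabanUV.T4Continuum.NE1p.DressedSmallFieldDepCoresWitness

end
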